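import Literature.Topology.FourManifolds.PointPushDiffeotopy
import Literature.Topology.FourManifolds.TwoDiscsDiffeotopy
import Mathlib.Topology.MetricSpace.HausdorffDimension
import Mathlib.Analysis.Calculus.ContDiff.RCLike
import HarnessLib

/-!
# Paths in manifolds of dimension `≥ 2` avoid finitely many points

Topic `Literature/Topology/FourManifolds` (fact seat
`provefact-Literature.Topology.FourManifolds.lauden-f709dd520c`, Laudenbach–Poénaru's Lemma 2:
the loop along which a foot of a `1`-handle is dragged in the handle slide `H₃` must miss the
other foot and the base point).  Everything here is **proved**; no definitions, no named facts.

* `interior_range_eq_empty_of_contMDiff` — the image of a `C¹` curve `ℝ → M` in a manifold of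
  dimension `n ≥ 2` has empty interior (Hausdorff dimension `≤ 1 < n` in charts,
  `dimH_image_le_of_locally_lipschitzOn`);
* `IsPreconnected.diff_finset` — removing finitely many points from a preconnected open set of
  a manifold of dimension `≥ 2` keeps it preconnected;
* `Path.exists_homotopic_disjoint_finset_of_interior_eq_empty` — a path with nowhere dense image
  missing a finite set `F` at its end points is homotopic rel end points, inside a preconnected
  open `U`, to a path missing `F`: push each obstacle off the image by a point push supported in
  `U` away from the end points and the other obstacles, and compose the path with the inverse
  diffeomorphism ("general position by moving the obstacles");
* `Path.exists_homotopic_range_subset_disjoint_finset` — **every path is homotopic rel end points,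
  inside `U`, to a path missing `F`**: first replace the path by the track of a point push
  (`exists_diffeotopy_apply_eq_trackPath_homotopic`, a smooth curve), then move the obstacles.

This is the elementary general-position statement `πₖ(M ∖ F) → πₖ(M)` onto for `k = 1 < n`
(Hirsch 1976, Ch. 3 §2, Thm. 2.5: maps of a `k`-manifold into an `n`-manifold, `k < n`, are
approximable by maps missing a point; here with homotopies instead of approximations).

## References

* M. W. Hirsch, *Differential Topology*, GTM 33 (1976), Ch. 3 §2, Thm. 2.5; Ch. 8 §1, Thm. 1.3.
  [HirschDT1976]
-/

open scoped Manifold ContDiff Topology unitInterval ENNReal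
open Set Function Filter Metric Module

noncomputable section

namespace Literature.Topology.FourManifolds

variable {n : ℕ}

/-- Local notation: `𝔼 n` is the model Euclidean space `EuclideanSpace ℝ (Fin n)`. -/
local notation "𝔼 " n:arg => EuclideanSpace ℝ (Fin n)

variable {M : Type*} [TopologicalSpace M] [T2Space M] [ChartedSpace (𝔼 n) M]
  [IsManifold (𝓡 n) ∞ M]

/-! ### Smooth curves have nowhere dense image in dimension `≥ 2` -/

omit [T2Space M] in
/-- **The image of a `C¹` curve in a manifold of dimension `≥ 2` has empty interior**: in a
chart the curve is locally Lipschitz, so its image has Hausdorff dimension `≤ 1`, whereas open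
sets of `ℝⁿ` have Hausdorff dimension `n`. [folklore] -/
theorem interior_range_eq_empty_of_contMDiff (hn : 2 ≤ n) {c : ℝ → M}
    (hc : ContMDiff 𝓘(ℝ, ℝ) (𝓡 n) 1 c) : interior (range c) = ∅ := by
  by_contra hne
  obtain ⟨x, hx⟩ := nonempty_iff_ne_empty.2 hne
  set e := chartAt (𝔼 n) x with he
  -- an open piece of the image inside the chart domain
  set O : Set M := interior (range c) ∩ e.source with hO
  have hOo : IsOpen O := isOpen_interior.inter e.open_source
  have hxO : x ∈ O := ⟨hx, mem_chart_source _ x⟩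
  have hO' : IsOpen (e '' O) := e.isOpen_image_of_subset_source hOo inter_subset_right
  have hO'ne : (interior (e '' O)).Nonempty := by
    rw [hO'.interior_eq]; exact ⟨e x, mem_image_of_mem _ hxO⟩
  -- it is covered by the image of the curve read in the chart
  set s : Set ℝ := c ⁻¹' e.source with hs
  have hsub : e '' O ⊆ (e ∘ c) '' s := by
    rintro _ ⟨y, ⟨hy, hye⟩, rfl⟩
    obtain ⟨t, rfl⟩ := interior_subset hy
    exact ⟨t, hye, rfl⟩
  -- which has Hausdorff dimension `≤ 1`
  have hlip : ∀ t ∈ s, ∃ C : NNReal, ∃ u ∈ 𝓝[s] t, LipschitzOnWith C (e ∘ c) u := by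
    intro t ht
    haveI : IsManifold (𝓡 n) 1 M := IsManifold.of_le (n := ∞) (mod_cast le_top)
    have hg : ContMDiffAt (𝓡 n) (𝓡 n) 1 e (c t) :=
      (contMDiffOn_chart (x := x)).contMDiffAt (e.open_source.mem_nhds ht)
    have h1 : ContMDiffAt 𝓘(ℝ, ℝ) (𝓡 n) 1 (e ∘ c) t := hg.comp t (hc t)
    rw [contMDiffAt_iff_contDiffAt] at h1
    obtain ⟨C, u, hu, hC⟩ := h1.exists_lipschitzOnWith
    exact ⟨C, u, mem_nhdsWithin_of_mem_nhds hu, hC⟩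
  have hdim : dimH ((e ∘ c) '' s) ≤ 1 :=
    calc dimH ((e ∘ c) '' s) ≤ dimH s := dimH_image_le_of_locally_lipschitzOn hlip
      _ ≤ dimH (univ : Set ℝ) := dimH_mono (subset_univ _)
      _ = 1 := Real.dimH_univ
  -- contradiction with `dimH (open set of ℝⁿ) = n ≥ 2`
  have hdimO : dimH (e '' O) = n := by
    rw [Real.dimH_of_nonempty_interior hO'ne, finrank_euclideanSpace_fin]
  have h : (n : ℝ≥0∞) ≤ 1 := by
    rw [← hdimO]; exact (dimH_mono hsub).trans hdim
  have h2 : (2 : ℝ≥0∞) ≤ 1 := le_trans (by exact_mod_cast hn) h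
  exact absurd h2 (by norm_num)

/-! ### Removing finitely many points keeps open sets connected in dimension `≥ 2` -/

/-- **Removing one point**: if `W` is a preconnected open set of a manifold of dimension
`n ≥ 2`, so is `W ∖ {x}` (a full-target chart centred at `x` inside `W` is a neighbourhood whose
puncture is the image of the connected `ℝⁿ ∖ {0}`). [folklore] -/
theorem IsPreconnected.diff_singleton_of_two_le (hn : 2 ≤ n) {W : Set M} (hW : IsPreconnected W)
    (hWo : IsOpen W) (x : M) : IsPreconnected (W \ {x}) := by
  by_cases hx : x ∈ W
  swap
  · rwa [sdiff_singleton_eq_self hx]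
  obtain ⟨e, he, hxe, heW, het, he0⟩ :=
    exists_mem_maximalAtlas_target_eq_univ_source_subset_apply_eq_zero (n := n) x (hWo.mem_nhds hx)
  have hrank : 1 < Module.rank ℝ (𝔼 n) := by
    rw [← Module.finrank_eq_rank, finrank_euclideanSpace_fin]; exact_mod_cast hn
  have hpunct : e.source \ {x} = e.symm '' ({0}ᶜ : Set (𝔼 n)) := by
    ext y
    constructor
    · rintro ⟨hy, hyx⟩
      refine ⟨e y, fun h0 => hyx ?_, e.left_inv hy⟩
      have : e.symm (e y) = e.symm (e x) := by rw [show e y = 0 from h0, he0]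
      rwa [e.left_inv hy, e.left_inv hxe] at this
    · rintro ⟨z, hz, rfl⟩
      refine ⟨e.map_target (by rw [het]; trivial), fun h => hz ?_⟩
      have : e (e.symm z) = e x := by rw [show e.symm z = x from h]
      rwa [e.right_inv (by rw [het]; trivial), he0] at this
  have hS : IsPreconnected (e.source \ {x}) := by
    rw [hpunct]
    have hcont : ContinuousOn e.symm ({0}ᶜ : Set (𝔼 n)) := e.continuousOn_symm.mono (by rw [het]; exact subset_univ _)
    exact (isConnected_compl_singleton_of_one_lt_rank hrank 0).isPreconnected.image _ hcont
  exact IsPreconnected.diff_of_isPreconnected_diff hW isClosed_singleton e.open_source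
    (singleton_subset_iff.2 hxe) heW hS

/-- **Removing finitely many points** from a preconnected open set of a manifold of dimension
`≥ 2` keeps it preconnected (and open). [folklore] -/
theorem IsPreconnected.diff_finset (hn : 2 ≤ n) {W : Set M} (hW : IsPreconnected W)
    (hWo : IsOpen W) (F : Finset M) : IsPreconnected (W \ ↑F) := by
  classical
  induction F using Finset.induction_on with
  | empty => simpa using hW
  | insert a F ha ih =>
    have heq : W \ ↑(insert a F) = (W \ ↑F) \ {a} := by
      ext y
      simp only [Finset.coe_insert, Set.mem_sdiff, Set.mem_insert_iff, Set.mem_singleton_iff]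
      tauto
    rw [heq]
    exact IsPreconnected.diff_singleton_of_two_le hn ih (hWo.sdiff F.finite_toSet.isClosed) a

/-! ### Moving finitely many obstacles off a nowhere dense path -/

omit [T2Space M] [IsManifold (𝓡 n) ∞ M] in
/-- A stage of a diffeotopy which is the identity off `K` maps `K` onto itself; in particular the
inverse of its end stage maps `K` into `K`. [folklore] -/
theorem Diffeomorph.symm_apply_mem_of_forall_eq_self {K : Set M} {P : M ≃ₘ⟮𝓡 n, 𝓡 n⟯ M}
    (hP : ∀ x, x ∉ K → P x = x) {x : M} (hx : x ∈ K) : P.symm x ∈ K := by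
  by_contra h
  have h1 : P (P.symm x) = P.symm x := hP _ h
  rw [P.apply_symm_apply] at h1
  exact h (h1 ▸ hx)

/-- **Moving the obstacles off a nowhere dense path.**  Let `U` be a preconnected open set of a
Hausdorff smooth manifold of dimension `n ≥ 2`, `γ` a path in `U` from `p` to `q` whose image has
empty interior, and `F` a finite set of points other than `p`, `q`.  Then `γ` is homotopic rel end
points to a path in `U` missing `F`.  Proof, one obstacle `f ∈ U` at a time: choose `y ∈ U` off
the image, off `F` and `≠ p, q`; a point push `P` compactly diffeotopic to the identity inside
`U ∖ ({p, q} ∪ F ∖ {f})` (preconnected, `IsPreconnected.diff_finset`) carries `f` to `y`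
(`Diffeomorph.exists_isCompactlyDiffeotopicToIdIn_apply_eq`); then `P⁻¹ ∘ γ` misses `f`, still
misses the other obstacles (fixed by `P`), lies in `U`, has nowhere dense image, and is homotopic
to `γ` rel `p, q` through `P_s⁻¹ ∘ γ`. [cite: HirschDT1976, Ch. 8 §1, Thm. 1.3; Ch. 3 §2, Thm. 2.5] -/
theorem Path.exists_homotopic_disjoint_finset_of_interior_eq_empty (hn : 2 ≤ n) {U : Set M}
    (hUo : IsOpen U) (hU : IsPreconnected U) {p q : M} (γ : Path p q) (hγU : range γ ⊆ U)
    (hγ : interior (range γ) = ∅) (F : Finset M) (hp : p ∉ F) (hq : q ∉ F) :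
    ∃ γ' : Path p q, γ'.Homotopic γ ∧ range γ' ⊆ U ∧ Disjoint (range γ') ↑F := by
  classical
  suffices h : ∃ γ' : Path p q, γ'.Homotopic γ ∧ range γ' ⊆ U ∧ Disjoint (range γ') ↑F ∧
      interior (range γ') = ∅ by
    obtain ⟨γ', h1, h2, h3, -⟩ := h
    exact ⟨γ', h1, h2, h3⟩
  induction F using Finset.induction_on with
  | empty => exact ⟨γ, Path.Homotopic.refl γ, hγU, by simp, hγ⟩
  | insert f F hfF ih =>
    obtain ⟨γ₀, hγ₀, hγ₀U, hγ₀F, hγ₀i⟩ := ih (fun h => hp (Finset.mem_insert_of_mem h))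
      (fun h => hq (Finset.mem_insert_of_mem h))
    have hpf : f ≠ p := fun h => hp (h ▸ Finset.mem_insert_self f F)
    have hqf : f ≠ q := fun h => hq (h ▸ Finset.mem_insert_self f F)
    -- if `f` is not on the path, nothing to do
    by_cases hfr : f ∈ range γ₀
    swap
    · refine ⟨γ₀, hγ₀, hγ₀U, ?_, hγ₀i⟩
      rw [Finset.coe_insert, Set.disjoint_insert_right]
      exact ⟨hfr, hγ₀F⟩
    have hfU : f ∈ U := hγ₀U hfr
    -- the push region `W = U ∖ ({p, q} ∪ F)`
    set G : Finset M := insert p (insert q F) with hG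
    set W : Set M := U \ ↑G with hW
    have hWo : IsOpen W := hUo.sdiff G.finite_toSet.isClosed
    have hWc : IsPreconnected W := IsPreconnected.diff_finset hn hU hUo G
    have hWU : W ⊆ U := fun _ h => h.1
    have hfG : f ∉ G := by simp [hG, hpf, hqf, hfF]
    have hfW : f ∈ W := ⟨hfU, hfG⟩
    have hpW : p ∉ W := fun h => h.2 (by simp [hG])
    have hqW : q ∉ W := fun h => h.2 (by simp [hG])
    have hFW : ∀ z ∈ F, z ∉ W := fun z hz h => h.2 (by simp [hG, hz])
    -- a target point in `W` off the (closed, nowhere dense) image of `γ₀`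
    have hy : ∃ y ∈ W, y ∉ range γ₀ := by
      by_contra h
      push Not at h
      have hsub : W ⊆ interior (range γ₀) := interior_maximal (fun z hz => h z hz) hWo
      rw [hγ₀i] at hsub
      exact hsub hfW
    obtain ⟨y, hyW, hyr⟩ := hy
    -- push `f` to `y` inside `W`
    obtain ⟨P, hPd, hPf⟩ :=
      Diffeomorph.exists_isCompactlyDiffeotopicToIdIn_apply_eq (n := n) hWo hWc hfW hyW
    obtain ⟨D, K, hKc, hKW, hD1, hDK⟩ := hPd
    have hPt : ∀ t x, x ∉ W → D.toFun t x = x := fun t x hx => hDK t x fun h => hx (hKW h)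
    have hP1 : ∀ x, D.toFun 1 x = P x := fun x => by
      rw [← Diffeotopy.coe_stage, hD1]
    have hPfix : ∀ x, x ∉ W → P x = x := fun x hx => by rw [← hP1, hPt 1 x hx]
    have hPinv : ⇑P.symm = D.invFun 1 := by
      rw [← Diffeotopy.coe_stage_symm, hD1]
    have hinvfix : ∀ s x, x ∉ W → D.invFun s x = x := fun s x hx => by
      conv_lhs => rw [← hPt s x hx]
      exact D.invFun_toFun s x
    -- the new path `P⁻¹ ∘ γ₀`
    have hsrc : P.symm p = p := by rw [hPinv, hinvfix 1 p hpW]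
    have htgt : P.symm q = q := by rw [hPinv, hinvfix 1 q hqW]
    let γ₁ : Path p q :=
      { toFun := fun t => P.symm (γ₀ t)
        continuous_toFun := P.symm.continuous.comp γ₀.continuous
        source' := by rw [γ₀.source, hsrc]
        target' := by rw [γ₀.target, htgt] }
    have hγ₁ : ∀ t, γ₁ t = P.symm (γ₀ t) := fun t => rfl
    have hrange : range γ₁ = P.symm '' range γ₀ := by
      ext z
      simp only [mem_range, mem_image, hγ₁]
      constructor
      · rintro ⟨t, rfl⟩; exact ⟨γ₀ t, ⟨t, rfl⟩, rfl⟩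
      · rintro ⟨_, ⟨t, rfl⟩, rfl⟩; exact ⟨t, rfl⟩
    refine ⟨γ₁, ?_, ?_, ?_, ?_⟩
    · -- homotopy `s ↦ D_s⁻¹ ∘ γ₀` from `γ₀` to `γ₁`, rel end points
      refine Path.Homotopic.trans ?_ hγ₀
      refine Path.Homotopic.symm ⟨?_⟩
      exact
        { toFun := fun x => D.invFun x.1 (γ₀ x.2)
          continuous_toFun := D.contMDiff_uncurry_invFun.continuous.comp
            ((continuous_subtype_val.comp continuous_fst).prodMk (γ₀.continuous.comp continuous_snd))
          map_zero_left := fun t => by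
            show D.invFun ((0 : I) : ℝ) (γ₀ t) = γ₀ t
            rw [Set.Icc.coe_zero, D.invFun_zero]; rfl
          map_one_left := fun t => by
            show D.invFun ((1 : I) : ℝ) (γ₀ t) = γ₁ t
            rw [Set.Icc.coe_one, hγ₁, hPinv]
          prop' := fun s t ht => by
            show D.invFun (s : ℝ) (γ₀ t) = γ₀ t
            simp only [mem_insert_iff, mem_singleton_iff] at ht
            rcases ht with rfl | rfl
            · rw [γ₀.source, hinvfix _ p hpW]
            · rw [γ₀.target, hinvfix _ q hqW] }
    · -- inside `U`
      rintro _ ⟨t, rfl⟩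
      rw [hγ₁]
      by_cases hK : γ₀ t ∈ K
      · exact hWU (hKW (Diffeomorph.symm_apply_mem_of_forall_eq_self
          (fun x hx => by rw [← hP1, hDK 1 x hx]) hK))
      · have h1 : P (γ₀ t) = γ₀ t := by rw [← hP1, hDK 1 _ hK]
        have h2 : P.symm (γ₀ t) = γ₀ t := by
          conv_lhs => rw [← h1]
          exact P.symm_apply_apply _
        rw [h2]
        exact hγ₀U ⟨t, rfl⟩
    · -- misses `insert f F`
      rw [Finset.coe_insert, Set.disjoint_left]
      rintro _ ⟨t, rfl⟩ hz
      rw [hγ₁] at hz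
      have hz' : γ₀ t = P _ := (P.apply_symm_apply (γ₀ t)).symm
      rcases hz with h | h
      · rw [h, hPf] at hz'
        exact hyr ⟨t, hz'⟩
      · rw [hPfix _ (hFW _ h)] at hz'
        exact Set.disjoint_left.1 hγ₀F ⟨t, rfl⟩ (hz' ▸ h)
    · -- nowhere dense image
      rw [hrange, ← P.symm.coe_toHomeomorph, ← Homeomorph.image_interior, hγ₀i, image_empty]

/-! ### Every path avoids finitely many points, up to homotopy -/

/-- **Paths in manifolds of dimension `≥ 2` can be homotoped off finitely many points.**  Let
`U` be a preconnected open set of a Hausdorff smooth manifold of dimension `n ≥ 2`, `γ` a path in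
`U` from `p` to `q`, and `F` a finite set with `p, q ∉ F`.  Then there is a path `γ'` in `U` from
`p` to `q`, homotopic to `γ` rel end points and missing `F`.  Proof: the track of the point push
along `γ` (`exists_diffeotopy_apply_eq_trackPath_homotopic`) is a smooth curve homotopic to `γ`
in `U`, with nowhere dense image (`interior_range_eq_empty_of_contMDiff`); then move the obstacles
(`Path.exists_homotopic_disjoint_finset_of_interior_eq_empty`).  Equivalently,
`π₁(U ∖ F, p) → π₁(U, p)` is onto (general position, Hirsch 1976, Ch. 3 §2, Thm. 2.5, `k = 1 < n`).
[cite: HirschDT1976, Ch. 3 §2, Thm. 2.5; Ch. 8 §1, Thm. 1.3] -/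
theorem Path.exists_homotopic_range_subset_disjoint_finset (hn : 2 ≤ n) {U : Set M}
    (hUo : IsOpen U) (hU : IsPreconnected U) {p q : M} (γ : Path p q) (hγU : range γ ⊆ U)
    (F : Finset M) (hp : p ∉ F) (hq : q ∉ F) :
    ∃ γ' : Path p q, γ'.Homotopic γ ∧ range γ' ⊆ U ∧ Disjoint (range γ') ↑F := by
  obtain ⟨D, K, -, hKU, hS, -, -, h1, hhom⟩ :=
    exists_diffeotopy_apply_eq_trackPath_homotopic (n := n) γ hUo hγU
  set T : Path p q := (D.trackPath p).cast rfl h1.symm with hT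
  have hpU : p ∈ U := hγU ⟨0, γ.source⟩
  have hTt : ∀ t, T t = D.toFun t p := fun t => rfl
  have hTU : range T ⊆ U := by
    rintro _ ⟨t, rfl⟩
    rw [hTt]
    by_cases hpK : p ∈ K
    · exact hKU (D.toFun_mem_of_forall_eq_self (hS t) hpK)
    · rw [hS t p hpK]; exact hpU
  have hTi : interior (range T) = ∅ := by
    have hc : ContMDiff 𝓘(ℝ, ℝ) (𝓡 n) 1 fun t : ℝ => D.toFun t p :=
      (D.contMDiff_uncurry_toFun.comp (contMDiff_id.prodMk contMDiff_const)).of_le (mod_cast le_top)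
    have hsub : range T ⊆ range fun t : ℝ => D.toFun t p := by
      rintro _ ⟨t, rfl⟩; exact ⟨t, rfl⟩
    exact subset_empty_iff.1 ((interior_mono hsub).trans (interior_range_eq_empty_of_contMDiff hn hc).subset)
  obtain ⟨γ', hγ', hγ'U, hγ'F⟩ :=
    Path.exists_homotopic_disjoint_finset_of_interior_eq_empty hn hUo hU T hTU hTi F hp hq
  exact ⟨γ', hγ'.trans hhom, hγ'U, hγ'F⟩

end Literature.Topology.FourManifolds
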